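import Summits.QuantumFields.BalabanUV.Beta.D1BFx.ChartDefectCorrectorWords
import Summits.QuantumFields.BalabanUV.Beta.D1BFx.ChartDefectRepair

/-!
# `BalabanUV.Beta.D1BFx.ChartDefectCorrectorLead` — road «BF-x», binder row D1, PART 24-hyb HEAD RE-PAIRED, the OWNER's leg (c2), PART 3:
# **THE (lead)-TYPE DIFFERENCE IN THE SLICE-INTERNAL ALPHABET** — for ANY localised families `V`, `W`,
# `hessKer (GcombSh n 0) V W − hessKer G₀ V W` = the three conjugation-defect words of `ChartDefectRepair.conjDefect_words` with the corrector
# `P := idK + Ẽ`, `Ẽ := (psiKS (ctrOff (d+1) n) n − idK) ∘ axEc ρ_c n` (PART 1's `GcombSh_zero_eq_conj_Etilde`), and each vertex defect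
# `Pᵀ∘X∘P − X = Ẽᵀ∘X + X∘Ẽ + Ẽᵀ∘X∘Ẽ` (the word list of `ChartDefectLeadRecord.conj_sub_eq_three_words`, at `E := Ẽ`; re-derived in five lines so
that this file does not wait on that module's olean).

So the re-paired row (lead) of `ChartDefectHeadRepaired` (= this difference at `V := vertexOfK G₀ n S⁰`, `W := W̃_L`, `ChartDefectRepair.lead_record_eq_dressed` ∕
`ChartDefectLeadRecord.lead_pin_eq_dressed`) is written on the alphabet `{Ẽ, G₀, Ṽ, W̃}`: `Ẽ` commutes with the slice projector, squares to zero, reads in-block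
NON-comb bonds and writes face bonds (PART 1); no border letter `bhK` ∕ `Dsh` ∕ `𝒬` occurs (PART 2 shows the same for the insertion presentation).
Located, zero weight: the words are NOT priced here and NO n-law is asserted.

HONEST DEPENDENCY (cell records, verbatim): «continuum YM on T⁴ ⇐ BetaPertH ∧ nine spine estimates (0/9 proved); BetaPertH ⇐ (D1) ∧ (D4) ∧
CAP+tail; G-an2-4 gates asym, D1 and NE2/3/4.»  HONEST FRAMING (cell contract, verbatim): «discharging `BetaPertH` makes Bałaban's UV stability
UNCONDITIONAL — a real constructive-QFT result; it is NOT the continuum limit and NOT the Clay problem.»  THIS MODULE DISCHARGES NOTHING of the wall: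
[folklore] an instance BY NAME of `ChartDefectRepair.conjDefect_words` at PART 1's corrector + five lines of tame-kernel algebra; no definition,
no `def … : Prop`, nothing cited, 0 sorry, default heartbeats.  0∕4 row-D1 binders; (K) NOT closed; (J1) ONE OPEN ROW; NOT D1, NEVER «G-an2-4 closed»,
NOT `BetaPertH`, NOT continuum, NOT Clay.

ABSOLUTE RULE (cell charter, verbatim): «No internally-minted statement may enter as a cited fact. Every hypothesis is either kernel-proved in this
package or a verbatim quotation of a PUBLISHED theorem with page reference. The manuscript(s) under audit are NOT citable for their own disputed
steps — they are the thing under adjudication; programme-internal (2001/route/tribunal) claims are never citable.»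

Unit `b2b-balaban-beta-d1-p2` (road owner, gen 27), 2026-08-24; no existing file touched.
-/

noncomputable section

namespace Summit.QuantumFields.BalabanUV.Beta.D1BFx.ChartDefectCorrectorLead

open Literature.MathematicalPhysics.QuantumFieldTheory
open Literature.MathematicalPhysics.QuantumFieldTheory.Balaban1983to89
open Literature.MathematicalPhysics.QuantumFieldTheory.Balaban1983to89.Beta
open ExpKernelCalculus (MKer comp tadpole bubble hessKer)
open HessKerSchurResolvent (idK comp_idK_left comp_idK_right)
open OneStepResolventKernel (Fib)
open OneStepKernelFamily (KInvStep)
open AffineAveraging (Site box)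
open AveragingContoursRooted (ctr ctrOff ctrOff_mem_box)
open Summit.QuantumFields.BalabanUV.Beta.TameKernelCalculus
open Summit.QuantumFields.BalabanUV.Beta.ChartConjugationRelative (spr_comp)
open Summit.QuantumFields.BalabanUV.Beta.RelInvCongruenceKernel (trK_idK)
open Summit.QuantumFields.BalabanUV.Beta.RelInvNullShift (spr_add)
open Summit.QuantumFields.BalabanUV.Beta.AxialDressingRooted (axEc spr_axEc coDressKBmAt)
open Summit.QuantumFields.BalabanUV.Beta.CombChartStepJets (GcombSh)
open Summit.QuantumFields.BalabanUV.Beta.SymCorrectorKernel (psiKS)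
open Summit.QuantumFields.BalabanUV.Beta.D1BFx.ChartDefectResolvent (spr_G0bm_ctr)
open Summit.QuantumFields.BalabanUV.Beta.D1BFx.ChartDefectRepair (conjDefect_words)
open Summit.QuantumFields.BalabanUV.Beta.D1BFx.ChartDefectCorrectorWords (spr_E GcombSh_zero_eq_conj_Etilde)

variable {d : ℕ} (n : ℕ) [NeZero n]

/-- [folklore] The slice-internal unipotent `idK + Ẽ` is spread. -/
theorem spr_idK_add_Etilde :
    Spr (idK + comp (psiKS (ctrOff (d + 1) n) n - idK) (axEc (ctr (d + 1) n) n) : MKer (d + 1) (Fib d)) := by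
  have hn : 0 < n := Nat.pos_of_ne_zero (NeZero.ne n)
  exact spr_add spr_idK (spr_comp (spr_E hn (ctrOff_mem_box hn)) (spr_axEc _ n))

/-- [folklore] **THE (lead)-TYPE DIFFERENCE IN THE SLICE-INTERNAL ALPHABET**: for ANY localised families `V`, `W`, with `G₀ := coDressKBmAt ρ_c n (KInvStep n 0)`,
`P := idK + Ẽ`, `Ẽ := (psiKS (ctrOff (d+1) n) n − idK)∘axEc ρ_c n`, and the vertex defects `δV := Pᵀ∘V∘P − V`, `δW := Pᵀ∘W∘P − W`:
`hessKer (GcombSh n 0) V W μ ν z − hessKer G₀ V W μ ν z = ½·tadpole G₀ (δW μ0νz) − ½·(bubble G₀ (V μ0) (δV νz) + bubble G₀ (δV μ0) (V νz)) − ½·bubble G₀ (δV μ0) (δV νz)`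
(`GcombSh n 0 = P∘G₀∘Pᵀ`, PART 1; `ChartDefectRepair.conjDefect_words`). -/
theorem literal_sub_road_eq_conjDefect_words_Etilde
    {V : Fin (d + 1) → (Fin (d + 1) → ℤ) → MKer (d + 1) (Fib d)} {W : Fin (d + 1) → (Fin (d + 1) → ℤ) → Fin (d + 1) → (Fin (d + 1) → ℤ) → MKer (d + 1) (Fib d)}
    (hV : ∀ μ y, Loc (V μ y)) (hW : ∀ μ y ν y', Loc (W μ y ν y')) (μ ν : Fin (d + 1)) (z : Fin (d + 1) → ℤ) :
    hessKer (GcombSh (d := d) n 0) V W μ ν z - hessKer (coDressKBmAt (ctr (d + 1) n) n (KInvStep (d := d) n 0)) V W μ ν z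
      = (1 / 2) * tadpole (coDressKBmAt (ctr (d + 1) n) n (KInvStep (d := d) n 0))
            (comp (comp (trK (idK + comp (psiKS (ctrOff (d + 1) n) n - idK) (axEc (ctr (d + 1) n) n))) (W μ 0 ν z))
                (idK + comp (psiKS (ctrOff (d + 1) n) n - idK) (axEc (ctr (d + 1) n) n)) - W μ 0 ν z)
        - (1 / 2) * (bubble (coDressKBmAt (ctr (d + 1) n) n (KInvStep (d := d) n 0)) (V μ 0)
                (comp (comp (trK (idK + comp (psiKS (ctrOff (d + 1) n) n - idK) (axEc (ctr (d + 1) n) n))) (V ν z))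
                    (idK + comp (psiKS (ctrOff (d + 1) n) n - idK) (axEc (ctr (d + 1) n) n)) - V ν z)
            + bubble (coDressKBmAt (ctr (d + 1) n) n (KInvStep (d := d) n 0))
                (comp (comp (trK (idK + comp (psiKS (ctrOff (d + 1) n) n - idK) (axEc (ctr (d + 1) n) n))) (V μ 0))
                    (idK + comp (psiKS (ctrOff (d + 1) n) n - idK) (axEc (ctr (d + 1) n) n)) - V μ 0) (V ν z))
        - (1 / 2) * bubble (coDressKBmAt (ctr (d + 1) n) n (KInvStep (d := d) n 0))
            (comp (comp (trK (idK + comp (psiKS (ctrOff (d + 1) n) n - idK) (axEc (ctr (d + 1) n) n))) (V μ 0))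
                (idK + comp (psiKS (ctrOff (d + 1) n) n - idK) (axEc (ctr (d + 1) n) n)) - V μ 0)
            (comp (comp (trK (idK + comp (psiKS (ctrOff (d + 1) n) n - idK) (axEc (ctr (d + 1) n) n))) (V ν z))
                (idK + comp (psiKS (ctrOff (d + 1) n) n - idK) (axEc (ctr (d + 1) n) n)) - V ν z) := by
  rw [GcombSh_zero_eq_conj_Etilde n]
  exact conjDefect_words spr_G0bm_ctr (spr_idK_add_Etilde n) hV hW μ ν z

/-- [folklore] **EACH VERTEX DEFECT IN THREE `Ẽ`-WORDS**: `(idK + Ẽ)ᵀ∘X∘(idK + Ẽ) − X = Ẽᵀ∘X + X∘Ẽ + Ẽᵀ∘X∘Ẽ` for every localised `X`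
(the word list of `ChartDefectLeadRecord.conj_sub_eq_three_words`, at `E := Ẽ`) — every (lead) word carries one or two legs on the slice-internal corrector. -/
theorem conj_Etilde_sub_eq_three_words {X : MKer (d + 1) (Fib d)} (hX : Loc X) :
    comp (comp (trK (idK + comp (psiKS (ctrOff (d + 1) n) n - idK) (axEc (ctr (d + 1) n) n))) X)
        (idK + comp (psiKS (ctrOff (d + 1) n) n - idK) (axEc (ctr (d + 1) n) n)) - X
      = comp (trK (comp (psiKS (ctrOff (d + 1) n) n - idK) (axEc (ctr (d + 1) n) n))) X
        + comp X (comp (psiKS (ctrOff (d + 1) n) n - idK) (axEc (ctr (d + 1) n) n))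
        + comp (comp (trK (comp (psiKS (ctrOff (d + 1) n) n - idK) (axEc (ctr (d + 1) n) n))) X)
            (comp (psiKS (ctrOff (d + 1) n) n - idK) (axEc (ctr (d + 1) n) n)) := by
  have hn : 0 < n := Nat.pos_of_ne_zero (NeZero.ne n)
  set Et : MKer (d + 1) (Fib d) := comp (psiKS (ctrOff (d + 1) n) n - idK) (axEc (ctr (d + 1) n) n) with hEt
  have hE : Spr Et := spr_comp (spr_E hn (ctrOff_mem_box hn)) (spr_axEc _ n)
  have hI : Tame (idK : MKer (d + 1) (Fib d)) := spr_idK.tame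
  have hEtX : Loc (comp (trK Et) X) := hE.trK.comp_loc hX
  rw [trK_add, trK_idK, comp_add_left_tame hI hE.trK.tame hX.tame, comp_idK_left,
    comp_add_right_tame (hX.add hEtX).tame hI hE.tame, comp_idK_right, comp_add_left_tame hX.tame hEtX.tame hE.tame]
  abel

end Summit.QuantumFields.BalabanUV.Beta.D1BFx.ChartDefectCorrectorLead

end
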